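import Literature.AlgebraicGeometry.AbelianVarieties.MarkmanPhiExchange
import Literature.AlgebraicGeometry.Modules.BoxTensorComplexBaseChange
import Literature.AlgebraicGeometry.Modules.StrictlyPerfectResolutionTwist
import HarnessLib

/-!
# The box bridge for Markman's `Φ`: `(t_a^*R) ⊠ (P_α^∨ ⊗ S) ≅ (t_a × 1)^*(pr₂^*P_α^∨ ⊗ (R ⊠ S))` as complexes on `A × A`, and the
# manufacture `e₂ : Φ(Q(R ⊠ S)) ≅ Q𝓔 ↦ e₁ : Φ(Q((t_a^*R) ⊠ (P_α^∨ ⊗ S))) ≅ Q(t_p^*𝓔)`, `p = (a, α)` (Markman 2025 §9.3; Mukai (3.1))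

Layer `Literature/AlgebraicGeometry/AbelianVarieties`; sequel to `MarkmanPhiExchange` (ROW Φ-(iii): the functor isomorphism
`D⁺(pr₂^*P_α^∨ ⊗ –) ⋙ D⁺((t_a × 1)^*) ⋙ Φ ≅ Φ ⋙ D⁺(t_p^*)`) and `Modules/BoxTensorComplexBaseChange` (chain-level base change ∕ twist of
`⊠`). For complex abelian varieties this file PROVES (0 named facts, no instances):

* §1 on `A × B` (generic): the squares of `t_a × 1` with the projections and **`boxTensorComplexTwistTranslationIso`**:
  `(t_a^*•R) ⊠ (N ⊗ •S) ≅ (t_a × 1)^*•((pr₂^*N ⊗ –)•(R ⊠ S))` for complexes `R`, `S` of vector bundles and a finite locally free `N` on `B`,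
  and its COROLLARY AT RESOLUTIONS `boxTensorComplexResolutionIso` whose left side is literally
  `(R₂.pullbackIso (translationSchemeIso A a)).P ⊠ (S₂.twist hN hInv).P` (`StrictlyPerfectResolutionTwist`);
* §2 the reading in `D(Mod 𝒪_{A×B})`: **`Q((t_a^*•R) ⊠ (N ⊗ •S)) ≅ D((t_a × 1)^*)(D(pr₂^*N ⊗ –)(Q(R ⊠ S)))`** (Mathlib's
  `Functor.mapDerivedCategoryFactors` twice), i.e. `Plus.ι` of `(D⁺(pr₂^*N ⊗ –) ⋙ D⁺((t_a × 1)^*))⟨Q(R ⊠ S), h⟩`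
  (`RightDerivedFunctorPlusInjectiveModel.mapDerivedCategoryPlusCompιIso`);
* §3 (`B := A`, `(A, Θ)` principally polarised, `Φ = markmanPhiPlus A hΘ hK`, `p : (A × Â)(ℂ)`, `a = pr₁ p`, `α = pr₂ p`, `N = P_α^∨`):
  **`markmanPhi_boxIso_translate`** — from `e₂ : ι(Φ⟨Q(R₂.P ⊠ S₂.P), h₂⟩) ≅ Q𝓔` it RETURNS
  `e₁ : ι(Φ⟨Q((R₂.pullbackIso t_a).P ⊠ (S₂.twist P_α^∨).P), h₁⟩) ≅ Q(t_p^*•𝓔)` (ROW Φ-(iii) at `p` + §2 + `mapDerivedCategoryFactors` for `t_p^*`;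
  every exactness instance is discharged inside).

Everything is typed on `A.X ⊗ B.X` with the projections `(fst A.X B.X).left`, `(snd A.X B.X).left` (as in `MarkmanShearFourierFunctor` …
`MarkmanPhiExchange`); the socket's `A.boxTensorComplex B R S : CochainComplex (A.prod B).X.left.Modules ℤ` and `translationPullbackComplex
(A.prod Â) p 𝓔` are these terms by `rfl` (`AbelianVariety.prod_X`, `toSchemeHom_fst`, `prodTranslation`), to be `change`d by the consumer.
NOT here: any statement that `Φ` is full or an equivalence (Mukai Thm 2.2 ∕ (1d)), the shift and `[Θ ⊠ Θ] ⊗` of print's `Φ`, cocycles.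
Typed for the cell `pub-hodge-ring2` (plate F13c of crux 26512's (M1) library debt: with socket #3 it manufactures the socket's `e₁` from `e₂`
for any `𝓔`; a research route conditional on HC_CM, not a corollary — nothing in this file refers to it).

## References

* E. Markman, *Cycles on abelian 2n-folds of Weil type…*, arXiv:2502.03415 (2025), §9.3 p. 71 L46–69 (conjugating translations through `Φ̃`). [Markman2025SecantWeil]
* S. Mukai, *Duality between `D(X)` and `D(X̂)`…*, Nagoya Math. J. 81 (1981), §3 (3.1) p. 158. [Mukai1981]
* The Stacks Project, Tag 0FXX (`K ⊠ M`), Tag 01CA (Lemma 17.16.4). [StacksProject]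
* C. A. Weibel, *An introduction to homological algebra* (1994), 10.5.2 (exact functors on `D`). [Weibel1994]
-/

noncomputable section

-- `TopCat.Presheaf`/`Scheme.Modules` are not reducible (as in Mathlib's `AlgebraicGeometry/Modules/Sheaf.lean`).
set_option backward.isDefEq.respectTransparency false

open CategoryTheory CategoryTheory.Limits AlgebraicGeometry MonoidalCategory CartesianMonoidalCategory
open AlgebraicGeometry.Scheme.Modules

universe w₁ w₂ w₃ u

namespace Literature.AlgebraicGeometry.AbelianVarieties

open Literature.AlgebraicGeometry.Motives Literature.AlgebraicGeometry.Modules Literature.AlgebraicGeometry.KTheory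
open scoped MonObj

/-! ### §1 `(t_a^*•R) ⊠ (N ⊗ •S) ≅ (t_a × 1)^*•((pr₂^*N ⊗ –)•(R ⊠ S))` on `A × B` -/

section Box

variable (A B : AbelianVariety ℂ) (a : A.Points ℂ)

/-- `(t_a × 1) ≫ pr₁ = pr₁ ≫ t_a` on underlying schemes. [cite: GortzWedhorn2023, Def./Rem. 27.1 (p. 799)] -/
theorem fstTranslationIso_hom_comp_fst :
    (fstTranslationIso A a B).hom ≫ (fst A.X B.X).left = (fst A.X B.X).left ≫ (A.translation a).left := by
  change (A.translation a ▷ B.X).left ≫ (fst A.X B.X).left = (fst A.X B.X).left ≫ (A.translation a).left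
  rw [← Over.comp_left, ← Over.comp_left, whiskerRight_fst]

/-- `(t_a × 1) ≫ pr₂ = pr₂` on underlying schemes. [cite: GortzWedhorn2023, Def./Rem. 27.1 (p. 799)] -/
theorem fstTranslationIso_hom_comp_snd : (fstTranslationIso A a B).hom ≫ (snd A.X B.X).left = (snd A.X B.X).left := by
  change (A.translation a ▷ B.X).left ≫ (snd A.X B.X).left = (snd A.X B.X).left
  rw [← Over.comp_left, whiskerRight_snd]

/-- **`(t_a^*•R) ⊠ (N ⊗ •S) ≅ (t_a × 1)^*•((pr₂^*N ⊗ –)•(R ⊠ S))`** as cochain complexes on `A × B`, for complexes `R` (on `A`), `S` (on `B`) of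
vector bundles and a finite locally free `N` on `B` (`Modules/BoxTensorComplexBaseChange.boxTensorComplexTwistPullbackIso` along the span
automorphism `(t_a × 1, t_a)`). [cite: StacksProject, Tag 0FXX and Tag 01CA (Lemma 17.16.4)] [cite: GortzWedhorn2023, Def./Rem. 27.1 (p. 799)] -/
def boxTensorComplexTwistTranslationIso (R : CochainComplex A.X.left.Modules ℤ) (S : CochainComplex B.X.left.Modules ℤ)
    (hR : ∀ i, IsFiniteLocallyFree (R.X i)) (hS : ∀ j, IsFiniteLocallyFree (S.X j)) {N : B.X.left.Modules} (hN : IsFiniteLocallyFree N) :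
    haveI : ((tensorBifunctor B.X.left).obj N).Additive := additive_tensorBifunctor_obj N
    haveI : ((tensorBifunctor (A.X ⊗ B.X).left).obj ((Scheme.Modules.pullback (snd A.X B.X).left).obj N)).Additive :=
      additive_tensorBifunctor_obj _
    boxTensorComplex (fst A.X B.X).left (snd A.X B.X).left
        (((Scheme.Modules.pullback (A.translation a).left).mapHomologicalComplex (ComplexShape.up ℤ)).obj R)
        ((((tensorBifunctor B.X.left).obj N).mapHomologicalComplex (ComplexShape.up ℤ)).obj S) ≅
      ((Scheme.Modules.pullback (fstTranslationIso A a B).hom).mapHomologicalComplex (ComplexShape.up ℤ)).obj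
        (((((tensorBifunctor (A.X ⊗ B.X).left).obj ((Scheme.Modules.pullback (snd A.X B.X).left).obj N)).mapHomologicalComplex
          (ComplexShape.up ℤ)).obj (boxTensorComplex (fst A.X B.X).left (snd A.X B.X).left R S))) :=
  boxTensorComplexTwistPullbackIso R S hR hS (fstTranslationIso_hom_comp_fst A B a) (fstTranslationIso_hom_comp_snd A B a) hN

/-- **The corollary at resolutions**: for strictly perfect resolutions `R₂` (on `A`), `S₂` (on `B`) and an invertible finite locally free `N`
on `B`, `(R₂.pullbackIso t_a).P ⊠ (S₂.twist N).P ≅ (t_a × 1)^*•((pr₂^*N ⊗ –)•(R₂.P ⊠ S₂.P))` — the left side is the box of the resolutions of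
`t_a^*G` and `N ⊗ H` supplied by `StrictlyPerfectResolutionTwist` (`pullbackIso_P`, `twist_P` are `rfl`). [cite: StacksProject, Tag 0FXX]
[cite: Hartshorne1977, III Prop. 6.7 and Ex. 6.5] -/
def boxTensorComplexResolutionIso {G : A.X.left.Modules} (R₂ : StrictlyPerfectResolution G) {H : B.X.left.Modules}
    (S₂ : StrictlyPerfectResolution H) {N : B.X.left.Modules} (hN : IsFiniteLocallyFree N) (hInv : IsInvertibleModule N) :
    haveI : ((tensorBifunctor (A.X ⊗ B.X).left).obj ((Scheme.Modules.pullback (snd A.X B.X).left).obj N)).Additive :=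
      additive_tensorBifunctor_obj _
    boxTensorComplex (fst A.X B.X).left (snd A.X B.X).left (R₂.pullbackIso (translationSchemeIso A a)).P (S₂.twist hN hInv).P ≅
      ((Scheme.Modules.pullback (fstTranslationIso A a B).hom).mapHomologicalComplex (ComplexShape.up ℤ)).obj
        (((((tensorBifunctor (A.X ⊗ B.X).left).obj ((Scheme.Modules.pullback (snd A.X B.X).left).obj N)).mapHomologicalComplex
          (ComplexShape.up ℤ)).obj (boxTensorComplex (fst A.X B.X).left (snd A.X B.X).left R₂.P S₂.P))) :=
  boxTensorComplexTwistTranslationIso A B a R₂.P S₂.P R₂.isBoundedVB.isFiniteLocallyFree S₂.isBoundedVB.isFiniteLocallyFree hN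

end Box

/-! ### §2 The reading in the derived category -/

section Derived

variable (A B : AbelianVariety ℂ) (a : A.Points ℂ) [HasDerivedCategory.{w₁} (A.X ⊗ B.X).left.Modules]

/-- **`Q((t_a^*•R) ⊠ (N ⊗ •S)) ≅ D((t_a × 1)^*)(D(pr₂^*N ⊗ –)(Q(R ⊠ S)))`** in `D(Mod 𝒪_{A×B})`: `Q` of §1, then Mathlib's
`Functor.mapDerivedCategoryFactors` for the two exact functors. Exactness instances of `T_N := pr₂^*N ⊗ –` and `(t_a × 1)^*` are binders.
[cite: Weibel1994, 10.5.2] [cite: StacksProject, Tag 0FXX] -/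
def Q_boxTensorComplexTwistTranslationIso (R : CochainComplex A.X.left.Modules ℤ) (S : CochainComplex B.X.left.Modules ℤ)
    (hR : ∀ i, IsFiniteLocallyFree (R.X i)) (hS : ∀ j, IsFiniteLocallyFree (S.X j)) {N : B.X.left.Modules} (hN : IsFiniteLocallyFree N)
    [((tensorBifunctor (A.X ⊗ B.X).left).obj ((Scheme.Modules.pullback (snd A.X B.X).left).obj N)).Additive]
    [PreservesFiniteLimits ((tensorBifunctor (A.X ⊗ B.X).left).obj ((Scheme.Modules.pullback (snd A.X B.X).left).obj N))]
    [PreservesFiniteColimits ((tensorBifunctor (A.X ⊗ B.X).left).obj ((Scheme.Modules.pullback (snd A.X B.X).left).obj N))]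
    [PreservesFiniteLimits (Scheme.Modules.pullback (fstTranslationIso A a B).hom)] :
    haveI : ((tensorBifunctor B.X.left).obj N).Additive := additive_tensorBifunctor_obj N
    DerivedCategory.Q.obj (boxTensorComplex (fst A.X B.X).left (snd A.X B.X).left
        (((Scheme.Modules.pullback (A.translation a).left).mapHomologicalComplex (ComplexShape.up ℤ)).obj R)
        ((((tensorBifunctor B.X.left).obj N).mapHomologicalComplex (ComplexShape.up ℤ)).obj S)) ≅
      (Scheme.Modules.pullback (fstTranslationIso A a B).hom).mapDerivedCategory.obj
        (((tensorBifunctor (A.X ⊗ B.X).left).obj ((Scheme.Modules.pullback (snd A.X B.X).left).obj N)).mapDerivedCategory.obj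
          (DerivedCategory.Q.obj (boxTensorComplex (fst A.X B.X).left (snd A.X B.X).left R S))) :=
  haveI : ((tensorBifunctor B.X.left).obj N).Additive := additive_tensorBifunctor_obj N
  DerivedCategory.Q.mapIso (boxTensorComplexTwistTranslationIso A B a R S hR hS hN) ≪≫
    ((Scheme.Modules.pullback (fstTranslationIso A a B).hom).mapDerivedCategoryFactors.app _).symm ≪≫
    (Scheme.Modules.pullback (fstTranslationIso A a B).hom).mapDerivedCategory.mapIso
      ((((tensorBifunctor (A.X ⊗ B.X).left).obj
        ((Scheme.Modules.pullback (snd A.X B.X).left).obj N)).mapDerivedCategoryFactors.app _).symm)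

/-- **The same as an isomorphism in `D⁺`**: for `h : Q(R ⊠ S) ∈ D⁺` and `h' : Q((t_a^*•R) ⊠ (N ⊗ •S)) ∈ D⁺`,
`⟨Q((t_a^*•R) ⊠ (N ⊗ •S)), h'⟩ ≅ (D⁺(pr₂^*N ⊗ –) ⋙ D⁺((t_a × 1)^*))⟨Q(R ⊠ S), h⟩` (`Plus.ι` is fully faithful and `D⁺(G)` is `D(G)` on
underlying objects). [cite: Weibel1994, 10.5.2] -/
def plusBoxTensorComplexTwistTranslationIso (R : CochainComplex A.X.left.Modules ℤ) (S : CochainComplex B.X.left.Modules ℤ)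
    (hR : ∀ i, IsFiniteLocallyFree (R.X i)) (hS : ∀ j, IsFiniteLocallyFree (S.X j)) {N : B.X.left.Modules} (hN : IsFiniteLocallyFree N)
    [((tensorBifunctor (A.X ⊗ B.X).left).obj ((Scheme.Modules.pullback (snd A.X B.X).left).obj N)).Additive]
    [PreservesFiniteLimits ((tensorBifunctor (A.X ⊗ B.X).left).obj ((Scheme.Modules.pullback (snd A.X B.X).left).obj N))]
    [PreservesFiniteColimits ((tensorBifunctor (A.X ⊗ B.X).left).obj ((Scheme.Modules.pullback (snd A.X B.X).left).obj N))]
    [PreservesFiniteLimits (Scheme.Modules.pullback (fstTranslationIso A a B).hom)]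
    (h : haveI : ((tensorBifunctor B.X.left).obj N).Additive := additive_tensorBifunctor_obj N
      DerivedCategory.TStructure.t.plus (DerivedCategory.Q.obj (boxTensorComplex (fst A.X B.X).left (snd A.X B.X).left R S)))
    (h' : haveI : ((tensorBifunctor B.X.left).obj N).Additive := additive_tensorBifunctor_obj N
      DerivedCategory.TStructure.t.plus (DerivedCategory.Q.obj (boxTensorComplex (fst A.X B.X).left (snd A.X B.X).left
        (((Scheme.Modules.pullback (A.translation a).left).mapHomologicalComplex (ComplexShape.up ℤ)).obj R)
        ((((tensorBifunctor B.X.left).obj N).mapHomologicalComplex (ComplexShape.up ℤ)).obj S)))) :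
    haveI : ((tensorBifunctor B.X.left).obj N).Additive := additive_tensorBifunctor_obj N
    (⟨_, h'⟩ : DerivedCategory.Plus (A.X ⊗ B.X).left.Modules) ≅
      ((((tensorBifunctor (A.X ⊗ B.X).left).obj ((Scheme.Modules.pullback (snd A.X B.X).left).obj N)).mapDerivedCategoryPlus ⋙
        (Scheme.Modules.pullback (fstTranslationIso A a B).hom).mapDerivedCategoryPlus).obj ⟨_, h⟩) :=
  haveI : ((tensorBifunctor B.X.left).obj N).Additive := additive_tensorBifunctor_obj N
  DerivedCategory.Plus.ι.preimageIso
    (Q_boxTensorComplexTwistTranslationIso A B a R S hR hS hN ≪≫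
      (Scheme.Modules.pullback (fstTranslationIso A a B).hom).mapDerivedCategory.mapIso
        ((Functor.mapDerivedCategoryPlusCompιIso
          ((tensorBifunctor (A.X ⊗ B.X).left).obj ((Scheme.Modules.pullback (snd A.X B.X).left).obj N))).app ⟨_, h⟩).symm ≪≫
      ((Functor.mapDerivedCategoryPlusCompιIso (Scheme.Modules.pullback (fstTranslationIso A a B).hom)).app _).symm)

end Derived

/-! ### §3 The manufacture `e₂ ↦ e₁` for Markman's `Φ` -/

section Manufacture

variable (A : AbelianVariety ℂ) {Θ : CartierDivisor A.X.left} (hΘ : Θ.IsAmple) (hK : A.KTheta Θ = ⊥)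
  [HasDerivedCategory.{w₁} (A.X ⊗ A.X).left.Modules]
  [HasDerivedCategory.{w₂} ((A.X ⊗ A.X) ⊗ (A.dualOf Θ hΘ).X).left.Modules]
  [HasDerivedCategory.{w₃} (A.X ⊗ (A.dualOf Θ hΘ).X).left.Modules]

/-- **`e₂ ↦ e₁`**: for a point `p = (a, α)` of `A × Â`, strictly perfect resolutions `R₂`, `S₂` on `A`, a complex `𝓔` on `A × Â` and an
isomorphism `e₂ : ι(Φ⟨Q(R₂.P ⊠ S₂.P), h₂⟩) ≅ Q𝓔` in `D(Mod 𝒪_{A×Â})` (`Φ = markmanPhiPlus A hΘ hK`, `ι = DerivedCategory.Plus.ι`), the isomorphism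
**`e₁ : ι(Φ⟨Q((R₂.pullbackIso t_a).P ⊠ (S₂.twist P_α^∨).P), h₁⟩) ≅ Q(t_p^*•𝓔)`** — the box of the resolutions of `t_a^*G` and `P_α^∨ ⊗ H` goes to
the translate of `𝓔` by `p` (ROW Φ-(iii) of `MarkmanPhiExchange` at `p`, the box bridge of §2, and `D(t_p^*) ∘ Q ≅ Q ∘ t_p^*•`). All exactness
instances are discharged here; `P_α^∨ := Modules.dual (linePt A hΘ hK α)` is invertible by `isInvertibleModule_of_hasRank_one`.
[cite: Markman2025SecantWeil, §9.3 p. 71 L46–69] [cite: Mukai1981, §3 (3.1) p. 158] -/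
def markmanPhi_boxIso_translate (p : (A.prod (A.dualOf Θ hΘ)).Points ℂ) {G : A.X.left.Modules} (R₂ : StrictlyPerfectResolution G)
    {H : A.X.left.Modules} (S₂ : StrictlyPerfectResolution H) (𝓔 : CochainComplex (A.X ⊗ (A.dualOf Θ hΘ).X).left.Modules ℤ)
    (h₂ : DerivedCategory.TStructure.t.plus
      (DerivedCategory.Q.obj (boxTensorComplex (fst A.X A.X).left (snd A.X A.X).left R₂.P S₂.P)))
    (h₁ : DerivedCategory.TStructure.t.plus
      (DerivedCategory.Q.obj (boxTensorComplex (fst A.X A.X).left (snd A.X A.X).left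
        (R₂.pullbackIso (translationSchemeIso A (p ≫ fst A.X (A.dualOf Θ hΘ).X))).P
        (S₂.twist (isFiniteLocallyFree_dual (isFiniteLocallyFree_linePt A hΘ hK (p ≫ snd A.X (A.dualOf Θ hΘ).X)))
          (isInvertibleModule_of_hasRank_one
            (isFiniteLocallyFree_dual (isFiniteLocallyFree_linePt A hΘ hK (p ≫ snd A.X (A.dualOf Θ hΘ).X)))
            (hasRank_dual (hasRank_linePt A hΘ hK (p ≫ snd A.X (A.dualOf Θ hΘ).X))))).P)))
    (e₂ : DerivedCategory.Plus.ι.obj ((markmanPhiPlus A hΘ hK).obj ⟨_, h₂⟩) ≅ DerivedCategory.Q.obj 𝓔) :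
    DerivedCategory.Plus.ι.obj ((markmanPhiPlus A hΘ hK).obj ⟨_, h₁⟩) ≅
      DerivedCategory.Q.obj (((Scheme.Modules.pullback (prodTranslationSchemeIso A (A.dualOf Θ hΘ) p).hom).mapHomologicalComplex
        (ComplexShape.up ℤ)).obj 𝓔) := by
  let a : A.Points ℂ := p ≫ fst A.X (A.dualOf Θ hΘ).X
  let α : (A.dualOf Θ hΘ).Points ℂ := p ≫ snd A.X (A.dualOf Θ hΘ).X
  have hN : IsFiniteLocallyFree (Modules.dual (linePt A hΘ hK α)) := isFiniteLocallyFree_dual (isFiniteLocallyFree_linePt A hΘ hK α)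
  have hN₁ : HasRank (Modules.dual (linePt A hΘ hK α)) 1 := hasRank_dual (hasRank_linePt A hΘ hK α)
  haveI := additive_tensorBifunctor_obj ((Scheme.Modules.pullback (snd A.X A.X).left).obj (Modules.dual (linePt A hΘ hK α)))
  haveI := (isInvertibleModule_of_hasRank_one (hN.pullback (snd A.X A.X).left) (hasRank_pullback _ hN₁)).preservesFiniteLimits
  haveI := (isInvertibleModule_of_hasRank_one (hN.pullback (snd A.X A.X).left) (hasRank_pullback _ hN₁)).preservesFiniteColimits
  haveI := preservesFiniteLimits_pullback_fstTranslation A a A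
  haveI := preservesFiniteLimits_pullback_prodTranslation A (A.dualOf Θ hΘ) p
  let Φ := markmanPhiPlus A hΘ hK
  let tp := Scheme.Modules.pullback (prodTranslationSchemeIso A (A.dualOf Θ hΘ) p).hom
  -- `X₁ ≅ (D⁺(T_N) ⋙ D⁺((t_a × 1)^*)) X₂` in `D⁺(Mod 𝒪_{A×A})`
  let e₁₂ := plusBoxTensorComplexTwistTranslationIso A A a R₂.P S₂.P R₂.isBoundedVB.isFiniteLocallyFree
    S₂.isBoundedVB.isFiniteLocallyFree hN h₂ h₁
  -- through `Φ` and ROW Φ-(iii), then down to `D` along `ι`, `e₂`, and the factorisation of `D(t_p^*)` through `Q`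
  exact DerivedCategory.Plus.ι.mapIso (Φ.mapIso e₁₂ ≪≫ (markmanPhi_exchange_iso A hΘ hK p).app ⟨_, h₂⟩) ≪≫
    (Functor.mapDerivedCategoryPlusCompιIso tp).app _ ≪≫ tp.mapDerivedCategory.mapIso e₂ ≪≫ tp.mapDerivedCategoryFactors.app 𝓔

end Manufacture

end Literature.AlgebraicGeometry.AbelianVarieties

end
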